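import Literature.NumberTheory.DiophantineApproximation.RhinViolaLemma26Integrals
import Literature.NumberTheory.DiophantineApproximation.DilogHermitePadeArithmetic
import HarnessLib

/-!
# Rhin–Viola 2005, Lemma 2.4: Theorem 2.1 for the tuples `(0, 0, k, 0, 0)`, `k ≥ 1`

Topic `Literature/NumberTheory/DiophantineApproximation`. DEFINITIONS (the integer polynomials `lemma24P`,
`lemma24R`) and proved theorems; no named facts. Source: G. Rhin, C. Viola, *The permutation group method for
the dilogarithm*, Ann. Sc. Norm. Super. Pisa Cl. Sci. (5) 4 (2005) 389–437, Lemma 2.4 (pp. 397–399): if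
`h = j = l = m = 0` then Theorem 2.1 holds, with `Q = 0` if `k > 0`; here `H = K = α = β = δ = k` and

  `I_z^{(1)}(0,0,k,0,0) = (1/k)((z−1)^{−k} − z^{−k})` (2.16),  `I_z^{(2)}(0,0,k,0,0) = 0` (2.15),
  `I_z(0,0,k,0,0) = −(1/(k z^k)) Σ_{r=1}^{k−1} (1/(k−r)) (z^r/(z−1)^r − 1)`,
  `d_{k−1} k z^k (z−1)^{k−1} I_z(0,0,k,0,0) ∈ ℤ[z]` of degree `≤ k − 1`.

(2.15)–(2.16) are in `RhinViolaResidueForm.lean` / `RhinViolaDoubleResidue.lean` (`I1_zero_k`, `I2_zero_k`).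
For `I_z` the paper integrates over `y` first by repeated partial integration ((2.18)–(2.19)); we integrate over
`x` first as in Lemma 2.6 ((2.20)), remove the apparent singularity at `y = 1` by the factorisation
`y^k((yz)^{−k} − (1+y(z−1))^{−k})/(1−y) = Σ_{r<k} z^{−(k−r)} y^r (1+y(z−1))^{−(r+1)}` (a geometric sum), evaluate
`∫₀¹ y^r dy/(1+y(z−1))^{r+1}` by the partial fractions of `RhinViolaPartialFractions.lean`, and cancel the
`log z` against `(log z) I^{(1)}` by the geometric identity `Σ_{r<k} z^{−(k−r)}(z−1)^{−(r+1)} = (z−1)^{−k} − z^{−k}`.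
The resulting closed form is
`I_z(0,0,k,0,0) = (1/k) Σ_{r<k} Σ_{i<r} C(r,i) (−1)^{r−i} (z^{i−r} − 1) z^{−(k−r)} (z−1)^{−(r+1)}/(i−r)`,
whence `P = d_k² z^k(z−1)^k I_z = Σ_{r<k} Σ_{i<r} (d_k²/(k(r−i))) C(r,i)(−1)^{r−i+1}(X^i − X^r)(X−1)^{k−1−r}` and
`R = d_k² z^k (z−1)^k I^{(1)} = (d_k²/k)(X^k − (X−1)^k)`.

## References

* G. Rhin, C. Viola, Ann. Sc. Norm. Super. Pisa Cl. Sci. (5) 4 (2005) 389–437, Lemma 2.4, (2.15)–(2.19).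
  [RhinViola2005]
-/

noncomputable section

namespace Literature.NumberTheory.DiophantineApproximation

namespace RhinViola

open _root_.MeasureTheory _root_.Set intervalIntegral Finset Polynomial
open DilogPade (polylogSeries)
open ViolaZudilin (unitSquare denom₁ measurableSet_unitSquare)

/-! ### The real integral `I_z^{(0)}(0,0,k,0,0)` -/

/-- The `x`-section at `(0,0,k,0,0)` (`0 < y < 1`, `z ≥ 1`, `k ≥ 1`):
`∫₀¹ y^k dx/(x(1−y)+yz)^{k+1} = y^k (1/(k(1−y)))((yz)^{−k} − (1−y+yz)^{−k})`. [cite: RhinViola2005, (2.20)] -/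
theorem integral_integrand_zero_zero_k_zero_zero_section {z y : ℝ} (hz : 1 ≤ z) (hy : y ∈ Ioo (0 : ℝ) 1)
    {k : ℕ} (hk : 1 ≤ k) :
    ∫ x in Icc (0 : ℝ) 1, integrand z 0 0 k 0 0 (x, y) =
      y ^ k * (1 / (k * (1 - y)) * (1 / (y * z) ^ k - 1 / (1 - y + y * z) ^ k)) := by
  have hint : ∀ x : ℝ, integrand z 0 0 k 0 0 (x, y) = y ^ k * (1 / (x * (1 - y) + y * z) ^ (k + 1)) := by
    intro x
    simp only [integrand, denom₁, pow_zero, one_mul, mul_one, Nat.zero_add]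
    ring
  simp_rw [hint]
  rw [integral_Icc_eq_integral_Ioc, ← integral_of_le zero_le_one, intervalIntegral.integral_const_mul,
    integral_inv_denom_pow hz hy hk]

/-- **The geometric factorisation removing the apparent pole at `y = 1`** (`0 < y < 1`, `z ≥ 1`):
`y^k ((yz)^{−k} − (1−y+yz)^{−k})/(k(1−y)) = (1/k) Σ_{r<k} z^{−(k−r)} y^r/(1+y(z−1))^{r+1}`. [folklore] -/
theorem section_eq_sum {z y : ℝ} (hz : 1 ≤ z) (hy : y ∈ Ioo (0 : ℝ) 1) (k : ℕ) :
    y ^ k * (1 / (k * (1 - y)) * (1 / (y * z) ^ k - 1 / (1 - y + y * z) ^ k)) =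
      1 / k * ∑ r ∈ range k, 1 / z ^ (k - r) * ((X : ℝ[X]) ^ r).eval y / (1 + y * (z - 1)) ^ (r + 1) := by
  have hy0 : y ≠ 0 := hy.1.ne'
  have hy1 : 1 - y ≠ 0 := by linarith [hy.2]
  have hz0 : z ≠ 0 := by linarith
  have hw : 0 < 1 + y * (z - 1) := by nlinarith [hy.1, hz]
  set a : ℝ := 1 / z with ha
  set b : ℝ := y / (1 + y * (z - 1)) with hb
  have hab : a - b = (1 - y) / (z * (1 + y * (z - 1))) := by
    rw [ha, hb]; field_simp; ring
  have hgeom := geom_sum₂_mul a b k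
  -- `y^k (yz)^{-k} = a^k`, `y^k (1 - y + yz)^{-k} = b^k`
  have e1 : y ^ k * (1 / (y * z) ^ k) = a ^ k := by rw [ha, mul_pow, div_pow, one_pow]; field_simp
  have e2 : y ^ k * (1 / (1 - y + y * z) ^ k) = b ^ k := by
    rw [hb, div_pow, show 1 - y + y * z = 1 + y * (z - 1) by ring]; field_simp
  calc y ^ k * (1 / (k * (1 - y)) * (1 / (y * z) ^ k - 1 / (1 - y + y * z) ^ k))
      = 1 / (k * (1 - y)) * (y ^ k * (1 / (y * z) ^ k) - y ^ k * (1 / (1 - y + y * z) ^ k)) := by ring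
    _ = 1 / (k * (1 - y)) * ((∑ i ∈ range k, a ^ i * b ^ (k - 1 - i)) * (a - b)) := by rw [e1, e2, hgeom]
    _ = 1 / k * ∑ i ∈ range k, a ^ i * b ^ (k - 1 - i) / (z * (1 + y * (z - 1))) := by
        rw [hab, Finset.sum_mul, Finset.mul_sum, Finset.mul_sum]
        refine sum_congr rfl fun i _ => ?_
        field_simp
    _ = 1 / k * ∑ r ∈ range k, 1 / z ^ (k - r) * ((X : ℝ[X]) ^ r).eval y / (1 + y * (z - 1)) ^ (r + 1) := by
        congr 1
        refine (sum_range_reflect _ k).symm.trans (sum_congr rfl fun r hr => ?_)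
        have hr' : r < k := mem_range.1 hr
        simp only [eval_pow, eval_X]
        rw [ha, hb, show k - 1 - (k - 1 - r) = r by omega, div_pow, div_pow, one_pow]
        rw [show k - r = (k - 1 - r) + 1 by omega, pow_succ, pow_succ]
        field_simp

/-- **`I_z^{(0)}(0,0,k,0,0)` with the `log z` separated** (`z > 1`, `k ≥ 1`), `y₁ = 1/(1−z)`:
`I^{(0)} = (1/k) Σ_{r<k} z^{−(k−r)} ( Σ_{i<r} (D^{(i)}Y^r)(y₁)(z^{i−r} − 1)(z−1)^{−(i+1)}/(i−r)`
`  + (z−1)^{−(r+1)} log z )`.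
[cite: RhinViola2005, (2.18)] -/
theorem I0_zero_zero_k_zero_zero {z : ℝ} (hz : 1 < z) {k : ℕ} (hk : 1 ≤ k) :
    I0 z 0 0 k 0 0 = 1 / k * ∑ r ∈ range k, 1 / z ^ (k - r) *
      ((∑ i ∈ (range (r + 1)).erase r, (hasseDeriv i ((X : ℝ[X]) ^ r)).eval (1 / (1 - z)) *
          ((z ^ ((i : ℤ) - (r + 1 : ℕ) + 1) - 1) * (z - 1) ^ (-((i : ℤ) + 1)) / ((i : ℝ) - (r + 1 : ℕ) + 1))) +
        (z - 1) ^ (-((r + 1 : ℕ) : ℤ)) * Real.log z) := by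
  -- Fubini, `x` first
  have hint : Integrable (integrand z 0 0 k 0 0)
      (((volume : Measure ℝ).restrict (Icc 0 1)).prod ((volume : Measure ℝ).restrict (Icc 0 1))) := by
    have hi := integrableOn_integrand hz.le 0 0 k 0 0
    rwa [IntegrableOn, ViolaZudilin.volume_restrict_unitSquare] at hi
  have hF : ∫ p in unitSquare, integrand z 0 0 k 0 0 p =
      ∫ y in Icc (0 : ℝ) 1, ∫ x in Icc (0 : ℝ) 1, integrand z 0 0 k 0 0 (x, y) := by
    rw [show (∫ p in unitSquare, integrand z 0 0 k 0 0 p) = ∫ p, integrand z 0 0 k 0 0 p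
        ∂((volume : Measure ℝ).restrict (Icc 0 1)).prod ((volume : Measure ℝ).restrict (Icc 0 1)) by
      rw [← ViolaZudilin.volume_restrict_unitSquare]]
    exact integral_prod_symm _ hint
  set f : ℕ → ℝ → ℝ := fun r y => 1 / z ^ (k - r) * ((X : ℝ[X]) ^ r).eval y / (1 + y * (z - 1)) ^ (r + 1)
    with hf
  have hinner : EqOn (fun y : ℝ => ∫ x in Icc (0 : ℝ) 1, integrand z 0 0 k 0 0 (x, y))
      (fun y => 1 / k * ∑ r ∈ range k, f r y) (Ioo (0 : ℝ) 1) := by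
    intro y hy
    simp only [hf]
    rw [integral_integrand_zero_zero_k_zero_zero_section hz.le hy hk, section_eq_sum hz.le hy k]
  have hden : ∀ r : ℕ, ∀ y ∈ Icc (0 : ℝ) 1, (1 + y * (z - 1)) ^ (r + 1) ≠ 0 := fun r y hy =>
    pow_ne_zero _ (by nlinarith [hy.1, hz] : (0 : ℝ) < 1 + y * (z - 1)).ne'
  have hfc : ∀ r, ContinuousOn (f r) (Icc (0 : ℝ) 1) := fun r =>
    (continuousOn_const.mul (Polynomial.continuous _).continuousOn).div (by fun_prop) (hden r)
  have hfi : ∀ r ∈ range k, IntervalIntegrable (f r) volume 0 1 := fun r _ =>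
    (hfc r).intervalIntegrable_of_Icc zero_le_one
  have hsum : IntegrableOn (fun y => 1 / (k : ℝ) * ∑ r ∈ range k, f r y) (Ioo (0 : ℝ) 1) := by
    refine ((continuousOn_const.mul (continuousOn_finsetSum _ fun r _ => hfc r)).integrableOn_Icc).mono_set
      Ioo_subset_Icc_self
  have hW : ∀ r ∈ range k, ∫ y in (0 : ℝ)..1, f r y = 1 / z ^ (k - r) *
      ((∑ i ∈ (range (r + 1)).erase r, (hasseDeriv i ((X : ℝ[X]) ^ r)).eval (1 / (1 - z)) *
          ((z ^ ((i : ℤ) - (r + 1 : ℕ) + 1) - 1) * (z - 1) ^ (-((i : ℤ) + 1)) / ((i : ℝ) - (r + 1 : ℕ) + 1))) +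
        (z - 1) ^ (-((r + 1 : ℕ) : ℤ)) * Real.log z) := by
    intro r _
    have hPF := integral_eval_div_pow_eq hz ((X : ℝ[X]) ^ r) (n := r + 1) (B := r + 1) (by omega)
      (by rw [natDegree_X_pow]; omega) le_rfl
    have hfr : f r = fun y => 1 / z ^ (k - r) * (((X : ℝ[X]) ^ r).eval y / (1 + y * (z - 1)) ^ (r + 1)) := by
      funext y; simp only [hf]; ring
    rw [hfr, intervalIntegral.integral_const_mul, hPF, Nat.add_sub_cancel,
      show hasseDeriv r ((X : ℝ[X]) ^ r) = 1 by rw [X_pow_eq_monomial, hasseDeriv_monomial]; simp,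
      eval_one, one_mul]
  rw [I0, hF, integral_Icc_eq_integral_Ioo, setIntegral_congr_fun measurableSet_Ioo hinner,
    ← integral_Ioc_eq_integral_Ioo, ← integral_of_le zero_le_one, intervalIntegral.integral_const_mul,
    integral_finsetSum hfi, sum_congr rfl hW]
  simp

/-- The geometric identity cancelling the logarithm:
`Σ_{r<k} z^{−(k−r)} (z−1)^{−(r+1)} = (z−1)^{−k} − z^{−k}` (`z > 1`). [folklore] -/
theorem sum_inv_pow_mul_inv_pow {z : ℝ} (hz : 1 < z) (k : ℕ) :
    ∑ r ∈ range k, 1 / z ^ (k - r) * (z - 1) ^ (-((r + 1 : ℕ) : ℤ)) = 1 / (z - 1) ^ k - 1 / z ^ k := by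
  have hz0 : z ≠ 0 := by positivity
  have hz1 : z - 1 ≠ 0 := by linarith
  have hgeom := geom_sum₂_mul z (z - 1) k
  rw [show z - (z - 1) = 1 by ring, mul_one] at hgeom
  -- multiply through by `z^k (z-1)^k`
  have key : ∀ r ∈ range k, 1 / z ^ (k - r) * (z - 1) ^ (-((r + 1 : ℕ) : ℤ)) =
      z ^ r * (z - 1) ^ (k - 1 - r) / (z ^ k * (z - 1) ^ k) := by
    intro r hr
    have hr' := mem_range.1 hr
    rw [zpow_neg, zpow_natCast, eq_div_iff (by positivity), show z ^ k = z ^ (k - r) * z ^ r by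
      rw [← pow_add, Nat.sub_add_cancel hr'.le], show (z - 1) ^ k = (z - 1) ^ (k - 1 - r) * (z - 1) ^ (r + 1) by
      rw [← pow_add]; congr 1; omega]
    field_simp
  rw [sum_congr rfl key, ← sum_div, hgeom]
  field_simp

/-- **`I_z(0,0,k,0,0)` in closed form** (`z > 1`, `k ≥ 1`), `y₁ = 1/(1−z)`:
`I_z(0,0,k,0,0) = (1/k) Σ_{r<k} z^{−(k−r)} Σ_{i<r} (D^{(i)}Y^r)(y₁)(z^{i−r} − 1)(z−1)^{−(i+1)}/(i−r)`.
[cite: RhinViola2005, Lemma 2.4, (2.18)–(2.19)] -/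
theorem I_zero_zero_k_zero_zero {z : ℝ} (hz : 1 < z) {k : ℕ} (hk : 1 ≤ k) :
    I z 0 0 k 0 0 = 1 / k * ∑ r ∈ range k, 1 / z ^ (k - r) *
      ∑ i ∈ (range (r + 1)).erase r, (hasseDeriv i ((X : ℝ[X]) ^ r)).eval (1 / (1 - z)) *
        ((z ^ ((i : ℤ) - (r + 1 : ℕ) + 1) - 1) * (z - 1) ^ (-((i : ℤ) + 1)) / ((i : ℝ) - (r + 1 : ℕ) + 1)) := by
  have hk0 : (0 : ℕ) < k := hk
  rw [I, I0_zero_zero_k_zero_zero hz hk, I1_zero_k hz hk0]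
  have hsplit : ∑ r ∈ range k, 1 / z ^ (k - r) *
      ((∑ i ∈ (range (r + 1)).erase r, (hasseDeriv i ((X : ℝ[X]) ^ r)).eval (1 / (1 - z)) *
          ((z ^ ((i : ℤ) - (r + 1 : ℕ) + 1) - 1) * (z - 1) ^ (-((i : ℤ) + 1)) / ((i : ℝ) - (r + 1 : ℕ) + 1))) +
        (z - 1) ^ (-((r + 1 : ℕ) : ℤ)) * Real.log z) =
      (∑ r ∈ range k, 1 / z ^ (k - r) *
        ∑ i ∈ (range (r + 1)).erase r, (hasseDeriv i ((X : ℝ[X]) ^ r)).eval (1 / (1 - z)) *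
          ((z ^ ((i : ℤ) - (r + 1 : ℕ) + 1) - 1) * (z - 1) ^ (-((i : ℤ) + 1)) / ((i : ℝ) - (r + 1 : ℕ) + 1))) +
      Real.log z * ∑ r ∈ range k, 1 / z ^ (k - r) * (z - 1) ^ (-((r + 1 : ℕ) : ℤ)) := by
    rw [mul_sum, ← sum_add_distrib]
    exact sum_congr rfl fun r _ => by ring
  rw [hsplit, sum_inv_pow_mul_inv_pow hz]
  ring

/-! ### The polynomials `P`, `R` of Lemma 2.4 -/

/-- `(D^{(i)} Y^r)(y) = C(r,i) y^{r−i}`. [folklore] -/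
theorem hasseDeriv_X_pow_eval (r i : ℕ) (y : ℝ) :
    (hasseDeriv i ((X : ℝ[X]) ^ r)).eval y = (r.choose i : ℝ) * y ^ (r - i) := by
  rw [X_pow_eq_monomial, hasseDeriv_monomial, eval_monomial, mul_one]

/-- `P = Σ_{r<k} Σ_{i<r} (d_k²/(k(i−r))) C(r,i) (−1)^{r−i} (X^i − X^r)(X−1)^{k−1−r}`.
[cite: RhinViola2005, Lemma 2.4 (proof)] -/
def lemma24P (k : ℕ) : ℤ[X] :=
  ∑ r ∈ range k, ∑ i ∈ (range (r + 1)).erase r,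
    C (((Nat.lcmUpto k * Nat.lcmUpto k : ℕ) : ℤ) / ((k : ℤ) * ((i : ℤ) - r)) * (r.choose i) * (-1) ^ (r - i)) *
      ((X ^ i - X ^ r) * (X - 1) ^ (k - 1 - r))

/-- `R = (d_k²/k)(X^k − (X−1)^k)` (from (2.17)). [cite: RhinViola2005, (2.17)] -/
def lemma24R (k : ℕ) : ℤ[X] :=
  C (((Nat.lcmUpto k * Nat.lcmUpto k : ℕ) : ℤ) / k) * (X ^ k - (X - 1) ^ k)

/-- `deg P ≤ k`. [cite: RhinViola2005, Lemma 2.4] -/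
theorem natDegree_lemma24P_le (k : ℕ) : (lemma24P k).natDegree ≤ k := by
  refine natDegree_sum_le_of_forall_le _ _ fun r hr => natDegree_sum_le_of_forall_le _ _ fun i hi => ?_
  have hr' := mem_range.1 hr
  have hi' : i < r + 1 := mem_range.1 (mem_erase.1 hi).2
  refine (natDegree_C_mul_le _ _).trans (natDegree_mul_le.trans ?_)
  have e1 : ((X : ℤ[X]) ^ i - X ^ r).natDegree ≤ r :=
    (natDegree_sub_le _ _).trans (max_le ((natDegree_X_pow i).le.trans (by omega)) (natDegree_X_pow r).le)
  have e2 : ((X - 1 : ℤ[X]) ^ (k - 1 - r)).natDegree ≤ k - 1 - r := by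
    have := natDegree_pow_le_of_le (k - 1 - r)
      (show (X - 1 : ℤ[X]).natDegree ≤ 1 from (natDegree_sub_le _ _).trans (by simp))
    simpa using this
  omega

/-- `deg R ≤ k`. [cite: RhinViola2005, Lemma 2.4] -/
theorem natDegree_lemma24R_le (k : ℕ) : (lemma24R k).natDegree ≤ k := by
  refine (natDegree_C_mul_le _ _).trans ((natDegree_sub_le _ _).trans (max_le (natDegree_X_pow k).le ?_))
  have := natDegree_pow_le_of_le k (show (X - 1 : ℤ[X]).natDegree ≤ 1 from (natDegree_sub_le _ _).trans (by simp))
  simpa using this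

/-- **Rhin–Viola 2005, Lemma 2.4, `I^{(1)}`** (`z > 1`, `k ≥ 1`): `d_k² z^k (z−1)^k I_z^{(1)}(0,0,k,0,0) = R(z)`
(i.e. (2.17): `k z^k(z−1)^k I^{(1)} = z^k − (z−1)^k`). [cite: RhinViola2005, (2.17)] -/
theorem lemma24_I1 {z : ℝ} (hz : 1 < z) {k : ℕ} (hk : 1 ≤ k) :
    (Nat.lcmUpto k : ℝ) * Nat.lcmUpto k * z ^ k * (z - 1) ^ k * I1 z 0 0 k 0 0 = aeval z (lemma24R k) := by
  have hz0 : z ≠ 0 := by positivity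
  have hz1 : z - 1 ≠ 0 := by linarith
  have hdvd : (k : ℤ) ∣ ((Nat.lcmUpto k * Nat.lcmUpto k : ℕ) : ℤ) := by
    rw [Nat.cast_mul]; exact (DilogPade.natCast_dvd_lcmUpto hk le_rfl).mul_left _
  have hk0 : ((k : ℤ) : ℝ) ≠ 0 := by exact_mod_cast (by omega : k ≠ 0)
  rw [I1_zero_k hz hk, lemma24R, map_mul, aeval_C, algebraMap_int_eq, eq_intCast, Int.cast_div hdvd hk0,
    map_sub, map_pow, map_pow, map_sub, aeval_X, map_one]
  push_cast
  field_simp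

/-- **Rhin–Viola 2005, Lemma 2.4, `I_z`** (`z > 1`, `k ≥ 1`): `d_k² z^k (z−1)^k I_z(0,0,k,0,0) = P(z)`.
[cite: RhinViola2005, Lemma 2.4, (2.18)–(2.19)] -/
theorem lemma24_I {z : ℝ} (hz : 1 < z) {k : ℕ} (hk : 1 ≤ k) :
    (Nat.lcmUpto k : ℝ) * Nat.lcmUpto k * z ^ k * (z - 1) ^ k * I z 0 0 k 0 0 = aeval z (lemma24P k) := by
  have hz0 : z ≠ 0 := by positivity
  have hz1 : z - 1 ≠ 0 := by linarith
  have hz1' : 1 - z ≠ 0 := by linarith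
  have hk0 : (k : ℝ) ≠ 0 := by exact_mod_cast (by omega : k ≠ 0)
  rw [I_zero_zero_k_zero_zero hz hk, lemma24P, map_sum, ← mul_assoc, mul_one_div, mul_sum]
  refine sum_congr rfl fun r hr => ?_
  have hr' := mem_range.1 hr
  rw [map_sum, mul_sum, mul_sum]
  refine sum_congr rfl fun i hi => ?_
  have hi1 : i ≠ r := (mem_erase.1 hi).1
  have hi2 : i < r + 1 := mem_range.1 (mem_erase.1 hi).2
  have hir : i < r := lt_of_le_of_ne (Nat.lt_succ_iff.1 hi2) hi1
  have hdvd : ((k : ℤ) * ((i : ℤ) - r)) ∣ ((Nat.lcmUpto k * Nat.lcmUpto k : ℕ) : ℤ) := by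
    rw [Nat.cast_mul]
    refine mul_dvd_mul (DilogPade.natCast_dvd_lcmUpto hk le_rfl) ?_
    have hd : (((r - i : ℕ) : ℤ)) ∣ (Nat.lcmUpto k : ℤ) := DilogPade.natCast_dvd_lcmUpto (by omega) (by omega)
    rw [show ((i : ℤ) - r) = -((r - i : ℕ) : ℤ) by omega]
    exact (neg_dvd).2 hd
  have hne : (((k : ℤ) * ((i : ℤ) - r) : ℤ) : ℝ) ≠ 0 := by
    push_cast
    refine mul_ne_zero hk0 ?_
    have : ((i : ℤ) - r) ≠ 0 := by omega
    exact_mod_cast this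
  have hne' : ((i : ℝ) - r) ≠ 0 := by
    have : ((i : ℤ) - r) ≠ 0 := by omega
    exact_mod_cast this
  rw [map_mul, aeval_C, algebraMap_int_eq, eq_intCast, Int.cast_mul, Int.cast_mul, Int.cast_div hdvd hne,
    hasseDeriv_X_pow_eval]
  simp only [map_mul, map_sub, map_pow, aeval_X, map_one, Int.cast_pow, Int.cast_neg, Int.cast_one,
    Int.cast_natCast]
  -- the powers: `z^k z^{-(k-r)} z^{i-r} = z^i`, `(z-1)^k (1/(1-z))^{r-i} (z-1)^{-(i+1)} = (-1)^{r-i}(z-1)^{k-1-r}`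
  have ez : z ^ k * (1 / z ^ (k - r)) * z ^ ((i : ℤ) - (r + 1 : ℕ) + 1) = z ^ i := by
    rw [← zpow_natCast, ← zpow_natCast, one_div, ← zpow_neg, ← zpow_add₀ hz0, ← zpow_add₀ hz0,
      ← zpow_natCast]
    congr 1; push_cast; omega
  have ez' : z ^ k * (1 / z ^ (k - r)) = z ^ r := by
    rw [show z ^ k = z ^ (k - r) * z ^ r by rw [← pow_add, Nat.sub_add_cancel hr'.le]]; field_simp
  have ey : (1 / (1 - z)) ^ (r - i) * (z - 1) ^ k * (z - 1) ^ (-((i : ℤ) + 1)) =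
      (-1) ^ (r - i) * (z - 1) ^ (k - 1 - r) := by
    rw [show (1 : ℝ) / (1 - z) = -1 * (z - 1)⁻¹ by field_simp; ring, mul_pow, ← zpow_natCast (z - 1)⁻¹,
      inv_zpow', ← zpow_natCast (z - 1) k, ← zpow_natCast (z - 1) (k - 1 - r), mul_assoc, mul_assoc,
      ← zpow_add₀ hz1, ← zpow_add₀ hz1]
    congr 2; omega
  calc (Nat.lcmUpto k : ℝ) * Nat.lcmUpto k * z ^ k * (z - 1) ^ k / k *
        (1 / z ^ (k - r) * ((r.choose i : ℝ) * (1 / (1 - z)) ^ (r - i) *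
          ((z ^ ((i : ℤ) - (r + 1 : ℕ) + 1) - 1) * (z - 1) ^ (-((i : ℤ) + 1)) / ((i : ℝ) - (r + 1 : ℕ) + 1))))
      = (Nat.lcmUpto k : ℝ) * Nat.lcmUpto k / (k * ((i : ℝ) - r)) * (r.choose i) *
          ((1 / (1 - z)) ^ (r - i) * (z - 1) ^ k * (z - 1) ^ (-((i : ℤ) + 1))) *
          (z ^ k * (1 / z ^ (k - r)) * z ^ ((i : ℤ) - (r + 1 : ℕ) + 1) - z ^ k * (1 / z ^ (k - r))) := by
        have hden : ((i : ℝ) - ((r + 1 : ℕ) : ℝ) + 1) = (i : ℝ) - r := by push_cast; ring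
        rw [hden]
        field_simp
    _ = _ := by
        rw [ez, ez', ey]
        push_cast
        ring

/-- **Rhin–Viola 2005, Lemma 2.4** (Theorem 2.1 for `(0,0,k,0,0)`, `k ≥ 1`; `H = K = α = β = δ = k`, `Q = 0`):
there are `P, R ∈ ℤ[X]` of degree `≤ k` with, for every real `z > 1`,
`d_k² z^k(z−1)^k I_z(0,0,k,0,0) = P(z)`, `d_k² z^k(z−1)^k I_z^{(1)}(0,0,k,0,0) = R(z)`, `I_z^{(2)}(0,0,k,0,0) = 0`.
[cite: RhinViola2005, Lemma 2.4] -/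
theorem lemma24 {k : ℕ} (hk : 1 ≤ k) :
    ∃ P R : ℤ[X], P.natDegree ≤ k ∧ R.natDegree ≤ k ∧
      ∀ z : ℝ, 1 < z →
        (Nat.lcmUpto k : ℝ) * Nat.lcmUpto k * z ^ k * (z - 1) ^ k * I z 0 0 k 0 0 = aeval z P ∧
        (Nat.lcmUpto k : ℝ) * Nat.lcmUpto k * z ^ k * (z - 1) ^ k * I1 z 0 0 k 0 0 = aeval z R ∧
        I2 z 0 0 k 0 0 = 0 :=
  ⟨lemma24P k, lemma24R k, natDegree_lemma24P_le k, natDegree_lemma24R_le k,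
    fun z hz => ⟨lemma24_I hz hk, lemma24_I1 hz hk, I2_zero_k z hk⟩⟩

end RhinViola

end Literature.NumberTheory.DiophantineApproximation

end
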